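import Summits.QuantumAdvantage.AdviceFreeQNC0.CounterDoob
import HarnessLib

/-!
# Counter strategies V — TWO-SIDED counters `WalkHardFTwoSidedCounterSharp p q`, PROVED (`3 ∤ p`, `3 ∤ q`)

Planner qa-qnc0-p2 g15, ROUND-15 (p2) §3.15 ADDENDUM 6 (statement VERBATIM from `line15/SketchR13.lean`): for `3 ∤ p, 3 ∤ q`,
every strategy of α's u-walk game whose cut `g` reads only `(W_{<g} mod p, W_{≥g} mod q)` wins on at most
`(2/3 + (8/3)·lcm(p,q)·q·√(12pq/(n+1)))·2ⁿ` inputs.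

PROOF (a reduction to `CounterDoob.weighted_lose_ge`, no new state space): put `m = lcm(p,q)` (`3 ∤ m`).  On the fibre
`{W_n ≡ β (mod q)}` the strategy IS the pure counter strategy mod `m` with table `b ↦ f(b mod p, (β − b) mod q)`
(`slice`, `slice_eq`), so `#{u : W_n ≡ β, LOSE_y} = Σ_{u LOSES for slice β} h^β_n(W_n mod m)` with the BINOMIAL weights
`h^β_t(b) = P(b + Bin(n−t, ½) ≡ β (mod q))` (`binW`; harmonic, in `[0,1]`, `h^β_n = [· ≡ β]`), and `weighted_lose_ge` gives
`≥ ⅓·#{W_n ≡ β} − 2m·2ⁿ√(12m/(n+1))`; summing over the `q` residues `β`: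
`#WIN ≤ (2/3 + 2mq·√(12m/(n+1)))·2ⁿ ≤ (2/3 + (8/3)·m·q·√(12pq/(n+1)))·2ⁿ` (`m ≤ pq`).
WHAT THIS IS NOT: windows and non-adapted low-degree cuts (the dense crux) are not covered; separation NOT moved.
-/

namespace Summit.QuantumAdvantage.AdviceFreeQNC0

open Finset

/-- **`WalkHardFTwoSidedCounterSharp p q`** — TWO-SIDED counters (planner qa-qnc0-p2 g15 `line15/SketchR13.lean`, verbatim):
for `3 ∤ p`, `3 ∤ q`, every strategy whose cut `g` reads only `(W_{<g} mod p, W_{≥g} mod q)` wins on at most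
`(2/3 + (8/3)·lcm(p,q)·q·√(12pq/(n+1)))·2ⁿ` inputs. -/
def WalkHardFTwoSidedCounterSharp (p q : ℕ) : Prop :=
  ¬ 3 ∣ p → ¬ 3 ∣ q → 0 < p → 0 < q → ∀ n c : ℕ, ∀ y : Fin (n + 1) → (Fin n → Bool) → Bool,
    (∀ g : Fin (n + 1), ∀ u v : Fin n → Bool,
        wtPrefix u g.val % p = wtPrefix v g.val % p →
        (wt u - wtPrefix u g.val) % q = (wt v - wtPrefix v g.val) % q →
        y g u = y g v) →
      ((Finset.univ.filter fun u : Fin n → Bool => ringWinU c y u = true).card : ℝ)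
        ≤ (2 / 3 + 8 / 3 * (Nat.lcm p q) * q * Real.sqrt (12 * p * q / (n + 1))) * (2 : ℝ) ^ n

namespace CounterLaw

variable {n : ℕ}

/-! ## §1 Weights -/

/-- `W_{<g} ≤ W`. -/
theorem wtPrefix_le_wt (u : Fin n → Bool) (g : ℕ) : wtPrefix u g ≤ wt u := by
  unfold wtPrefix wt
  exact card_le_card (fun i hi => by simp only [mem_filter, mem_univ, true_and] at hi ⊢; exact hi.2)

/-- the weight of a word peeled at its first bit. -/
theorem wt_cons {k : ℕ} (b : Bool) (v : Fin k → Bool) : wt (Fin.cons b v : Fin (k + 1) → Bool) = b.toNat + wt v := by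
  unfold wt
  rw [card_filter, card_filter, Fin.sum_univ_succ]
  simp only [Fin.cons_zero, Fin.cons_succ]
  cases b <;> simp

/-! ## §2 The `β`-slice of a two-sided counter strategy is a one-sided counter strategy mod `m` -/

section Slice

variable (m q : ℕ) (y : Fin (n + 1) → (Fin n → Bool) → Bool) (β : ZMod q)

open scoped Classical in
/-- the table of the `β`-slice: what `y g` does on inputs with `W_{<g} ≡ b (mod m)` and `W_n ≡ β (mod q)`. -/
noncomputable def sliceTab (g : Fin (n + 1)) (b : ZMod m) : Bool :=
  if h : ∃ v : Fin n → Bool, ((wtPrefix v g.val : ℕ) : ZMod m) = b ∧ ((wt v : ℕ) : ZMod q) = β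
  then y g (Classical.choose h) else false

/-- the `β`-slice strategy: a pure counter strategy mod `m`. -/
noncomputable def slice : Fin (n + 1) → (Fin n → Bool) → Bool :=
  fun g u => sliceTab m q y β g ((wtPrefix u g.val : ℕ) : ZMod m)

/-- the slice reads only `W_{<g} mod m`. -/
theorem slice_counter (g : Fin (n + 1)) (u v : Fin n → Bool)
    (h : wtPrefix u g.val % m = wtPrefix v g.val % m) : slice m q y β g u = slice m q y β g v := by
  unfold slice
  rw [(ZMod.natCast_eq_natCast_iff' _ _ _).mpr h]

variable {p : ℕ} {m q}

/-- on the fibre `W_n ≡ β (mod q)` the slice IS the two-sided strategy (`p ∣ m`, `q ∣ m`). -/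
theorem slice_eq (hpm : p ∣ m) (hqm : q ∣ m)
    (hy : ∀ g : Fin (n + 1), ∀ u v : Fin n → Bool,
        wtPrefix u g.val % p = wtPrefix v g.val % p →
        (wt u - wtPrefix u g.val) % q = (wt v - wtPrefix v g.val) % q → y g u = y g v)
    (u : Fin n → Bool) (hu : ((wt u : ℕ) : ZMod q) = β) (g : Fin (n + 1)) : slice m q y β g u = y g u := by
  have hex : ∃ v : Fin n → Bool, ((wtPrefix v g.val : ℕ) : ZMod m) = ((wtPrefix u g.val : ℕ) : ZMod m)
      ∧ ((wt v : ℕ) : ZMod q) = β := ⟨u, rfl, hu⟩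
  unfold slice sliceTab
  rw [dif_pos hex]
  obtain ⟨h1, h2⟩ := Classical.choose_spec hex
  set v := Classical.choose hex
  apply hy g v u
  · have := congrArg (ZMod.castHom hpm (ZMod p)) h1
    rw [map_natCast, map_natCast] at this
    exact (ZMod.natCast_eq_natCast_iff' _ _ _).mp this
  · have hq1 := congrArg (ZMod.castHom hqm (ZMod q)) h1
    rw [map_natCast, map_natCast] at hq1
    apply (ZMod.natCast_eq_natCast_iff' _ _ _).mp
    rw [Nat.cast_sub (wtPrefix_le_wt v g.val), Nat.cast_sub (wtPrefix_le_wt u g.val), hq1, h2, hu]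

/-- hence the same WIN bit on that fibre. -/
theorem ringWinU_slice (hpm : p ∣ m) (hqm : q ∣ m)
    (hy : ∀ g : Fin (n + 1), ∀ u v : Fin n → Bool,
        wtPrefix u g.val % p = wtPrefix v g.val % p →
        (wt u - wtPrefix u g.val) % q = (wt v - wtPrefix v g.val) % q → y g u = y g v)
    (c : ℕ) (u : Fin n → Bool) (hu : ((wt u : ℕ) : ZMod q) = β) :
    ringWinU c (slice m q y β) u = ringWinU c y u := by
  have hf : (univ.filter fun g : Fin (n + 1) => slice m q y β g u = true ∧ (c + g.val + walkExp u g.val) % 3 ≠ 0)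
      = univ.filter fun g : Fin (n + 1) => y g u = true ∧ (c + g.val + walkExp u g.val) % 3 ≠ 0 :=
    filter_congr fun g _ => by rw [slice_eq y β hpm hqm hy u hu g]
  unfold ringWinU
  rw [hf]

end Slice

/-! ## §3 Binomial (harmonic) weights -/

section Weights

variable {m : ℕ} (q n : ℕ) (hqm : q ∣ m) (β : ZMod q)

/-- `h^β_t(b) = P(b + Bin(n − t, ½) ≡ β mod q)`. -/
noncomputable def binW (t : ℕ) (b : ZMod m) : ℝ :=
  ((univ.filter fun v : Fin (n - t) → Bool =>
      ZMod.castHom hqm (ZMod q) b + ((wt v : ℕ) : ZMod q) = β).card : ℝ) / 2 ^ (n - t)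

/-- `0 ≤ h`. -/
theorem binW_nonneg (t : ℕ) (b : ZMod m) : 0 ≤ binW q n hqm β t b := by
  unfold binW; positivity

/-- `h ≤ 1`. -/
theorem binW_le_one (t : ℕ) (b : ZMod m) : binW q n hqm β t b ≤ 1 := by
  unfold binW
  rw [div_le_one (by positivity)]
  have h := card_filter_le (univ : Finset (Fin (n - t) → Bool))
    (fun v => ZMod.castHom hqm (ZMod q) b + ((wt v : ℕ) : ZMod q) = β)
  rw [card_univ, Fintype.card_fun, Fintype.card_bool, Fintype.card_fin] at h
  exact_mod_cast h

/-- the numerator as a sum of indicators. -/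
theorem binW_num (k : ℕ) (b : ZMod m) :
    ((univ.filter fun v : Fin k → Bool => ZMod.castHom hqm (ZMod q) b + ((wt v : ℕ) : ZMod q) = β).card : ℝ)
      = ∑ v : Fin k → Bool, if ZMod.castHom hqm (ZMod q) b + ((wt v : ℕ) : ZMod q) = β then (1 : ℝ) else 0 := by
  rw [card_filter]; push_cast; rfl

/-- **harmonicity**: `h_t(b) = ½ (h_{t+1}(b) + h_{t+1}(b+1))` for `t < n`. -/
theorem binW_harmonic {t : ℕ} (ht : t < n) (b : ZMod m) :
    binW q n hqm β t b = (binW q n hqm β (t + 1) b + binW q n hqm β (t + 1) (b + 1)) / 2 := by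
  unfold binW
  have hk : n - t = (n - (t + 1)) + 1 := by omega
  set k := n - (t + 1) with hkdef
  rw [hk, binW_num, binW_num, binW_num, pow_succ]
  -- peel the first bit of the `(k+1)`-word
  rw [← Fintype.sum_equiv (Fin.consEquiv fun _ : Fin (k + 1) => Bool)
    (fun cv : Bool × (Fin k → Bool) => if ZMod.castHom hqm (ZMod q) b
        + ((wt (Fin.cons cv.1 cv.2 : Fin (k + 1) → Bool) : ℕ) : ZMod q) = β then (1 : ℝ) else 0)
    _ (fun cv => rfl), Fintype.sum_prod_type]
  simp only [Fintype.sum_bool, wt_cons, Bool.toNat_true, Bool.toNat_false, Nat.cast_add, Nat.cast_one,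
    Nat.cast_zero, map_add, map_one, ← add_assoc, add_zero]
  have h2 : (2 : ℝ) ^ k ≠ 0 := by positivity
  field_simp
  ring

/-- at the end: `h_n(b) = [b ≡ β (mod q)]`. -/
theorem binW_last (b : ZMod m) : binW q n hqm β n b = if ZMod.castHom hqm (ZMod q) b = β then 1 else 0 := by
  unfold binW
  rw [Nat.sub_self, pow_zero, div_one]
  have hw : ∀ v : Fin 0 → Bool, wt v = 0 := fun v => by unfold wt; simp
  simp only [hw, Nat.cast_zero, add_zero]
  by_cases h : ZMod.castHom hqm (ZMod q) b = β
  · rw [if_pos h, filter_true_of_mem (fun v _ => h), card_univ, Fintype.card_fun, Fintype.card_bool, Fintype.card_fin]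
    norm_num
  · rw [if_neg h, filter_false_of_mem (fun v _ => h)]
    simp

end Weights

/-! ## §4 Assembly -/

/-- the LOSE count of `y`, sliced by `W_n mod q` and weighted by `h^β_n`. -/
theorem card_lose_eq_sum_slices {p m q : ℕ} [NeZero m] [NeZero q] (hpm : p ∣ m) (hqm : q ∣ m)
    (y : Fin (n + 1) → (Fin n → Bool) → Bool)
    (hy : ∀ g : Fin (n + 1), ∀ u v : Fin n → Bool,
        wtPrefix u g.val % p = wtPrefix v g.val % p →
        (wt u - wtPrefix u g.val) % q = (wt v - wtPrefix v g.val) % q → y g u = y g v)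
    (c : ℕ) :
    ((univ.filter fun u : Fin n → Bool => ringWinU c y u = false).card : ℝ)
      = ∑ β : ZMod q, ∑ u : Fin n → Bool,
          if ringWinU c (slice m q y β) u = false then binW q n hqm β n (ctrN m u n) else 0 := by
  rw [Finset.sum_comm, card_filter]
  push_cast
  refine sum_congr rfl fun u _ => ?_
  have hctr : ZMod.castHom hqm (ZMod q) (ctrN m u n) = ((wt u : ℕ) : ZMod q) := by
    unfold ctrN; rw [map_natCast, ConstBells.wtPrefix_self]
  simp only [binW_last, hctr]
  rw [← Finset.sum_filter, Finset.sum_ite_eq]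
  simp only [mem_filter, mem_univ, true_and, ringWinU_slice y _ hpm hqm hy c u rfl]

/-- **RUNG R13, TWO-SIDED — PROVED for all `p, q` with `3 ∤ p`, `3 ∤ q`.** -/
theorem walkHardFTwoSidedCounterSharp' (p q : ℕ) : WalkHardFTwoSidedCounterSharp p q := by
  intro h3p h3q hp hq n c y hy
  set m := Nat.lcm p q with hmdef
  have hm0 : 0 < m := Nat.lcm_pos hp hq
  haveI : NeZero m := ⟨hm0.ne'⟩
  haveI : NeZero q := ⟨hq.ne'⟩
  have hpm : p ∣ m := Nat.dvd_lcm_left p q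
  have hqm : q ∣ m := Nat.dvd_lcm_right p q
  have h3m : ¬ 3 ∣ m := fun h =>
    ((Nat.Prime.dvd_mul Nat.prime_three).mp (h.trans (Nat.lcm_dvd_mul p q))).elim h3p h3q
  have hmle : (m : ℝ) ≤ p * q := by exact_mod_cast Nat.le_of_dvd (Nat.mul_pos hp hq) (Nat.lcm_dvd_mul p q)
  -- split WIN/LOSE
  have hsplit : ((univ.filter fun u : Fin n → Bool => ringWinU c y u = true).card : ℝ)
      + ((univ.filter fun u : Fin n → Bool => ringWinU c y u = false).card : ℝ) = (2 : ℝ) ^ n := by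
    have h := card_filter_add_card_filter_not (s := (univ : Finset (Fin n → Bool)))
      (fun u : Fin n → Bool => ringWinU c y u = true)
    rw [card_univ, Fintype.card_fun, Fintype.card_bool, Fintype.card_fin] at h
    have e : (univ.filter fun u : Fin n → Bool => ¬ ringWinU c y u = true)
        = univ.filter fun u : Fin n → Bool => ringWinU c y u = false := by
      congr 1; ext u; simp
    rw [e] at h
    exact_mod_cast h
  -- per slice
  have hβ : ∀ β : ZMod q,
      ((univ.filter fun u : Fin n → Bool => ((wt u : ℕ) : ZMod q) = β).card : ℝ) / 3
        - 2 * m * (2 : ℝ) ^ n * Real.sqrt (12 * m / (n + 1))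
        ≤ ∑ u : Fin n → Bool, if ringWinU c (slice m q y β) u = false then binW q n hqm β n (ctrN m u n) else 0 := by
    intro β
    have h := weighted_lose_ge m (slice m q y β) h3m (slice_counter m q y β) c (binW q n hqm β)
      (fun t ht b => binW_harmonic q n hqm β ht b) (binW_nonneg q n hqm β) (binW_le_one q n hqm β)
    have hcount : ∑ u : Fin n → Bool, binW q n hqm β n (ctrN m u n)
        = ((univ.filter fun u : Fin n → Bool => ((wt u : ℕ) : ZMod q) = β).card : ℝ) := by
      rw [card_filter]; push_cast
      refine sum_congr rfl fun u _ => ?_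
      rw [binW_last]
      unfold ctrN; rw [map_natCast, ConstBells.wtPrefix_self]
    rw [hcount] at h
    exact h
  -- sum over the slices
  have hfib : ∑ β : ZMod q, ((univ.filter fun u : Fin n → Bool => ((wt u : ℕ) : ZMod q) = β).card : ℝ) = (2 : ℝ) ^ n := by
    rw [← Nat.cast_sum, ← card_eq_sum_card_fiberwise (s := univ) (t := univ)
      (f := fun u : Fin n → Bool => ((wt u : ℕ) : ZMod q)) (fun u _ => mem_univ _)]
    simp
  have hlose : (2 : ℝ) ^ n / 3 - q * (2 * m * (2 : ℝ) ^ n * Real.sqrt (12 * m / (n + 1)))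
      ≤ ((univ.filter fun u : Fin n → Bool => ringWinU c y u = false).card : ℝ) := by
    rw [card_lose_eq_sum_slices hpm hqm y hy c]
    have hs := sum_le_sum fun β (_ : β ∈ (univ : Finset (ZMod q))) => hβ β
    rw [sum_sub_distrib, ← sum_div, hfib, sum_const, card_univ, ZMod.card, nsmul_eq_mul] at hs
    exact hs
  -- compare the error terms: `2mq√(12m/(n+1)) ≤ (8/3)·m·q·√(12pq/(n+1))`
  have hsq : Real.sqrt (12 * m / (n + 1)) ≤ Real.sqrt (12 * p * q / (n + 1)) := by
    apply Real.sqrt_le_sqrt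
    apply div_le_div_of_nonneg_right _ (by positivity)
    linarith
  have hm' : (0 : ℝ) ≤ m := by positivity
  have hq' : (0 : ℝ) ≤ q := by positivity
  have hM : (0 : ℝ) < (2 : ℝ) ^ n := pow_pos (by norm_num) n
  have hs0 : 0 ≤ Real.sqrt (12 * m / (n + 1)) := Real.sqrt_nonneg _
  have herr : (q : ℝ) * (2 * m * (2 : ℝ) ^ n * Real.sqrt (12 * m / (n + 1)))
      ≤ 8 / 3 * m * q * Real.sqrt (12 * p * q / (n + 1)) * (2 : ℝ) ^ n := by
    have h1 : (q : ℝ) * m * Real.sqrt (12 * m / (n + 1)) ≤ q * m * Real.sqrt (12 * p * q / (n + 1)) :=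
      mul_le_mul_of_nonneg_left hsq (by positivity)
    nlinarith [mul_nonneg (mul_nonneg hq' hm') hs0]
  rw [show (Nat.lcm p q : ℝ) = m from by rw [hmdef]]
  linarith

end CounterLaw

/-- **RUNG R13, TWO-SIDED counters — PROVED for all `p, q` with `3 ∤ p`, `3 ∤ q`** (planner qa-qnc0-p2 g15 §3.15 add. 6). -/
theorem walkHardFTwoSidedCounterSharp (p q : ℕ) : WalkHardFTwoSidedCounterSharp p q :=
  CounterLaw.walkHardFTwoSidedCounterSharp' p q

end Summit.QuantumAdvantage.AdviceFreeQNC0
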